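import Mathlib
import Literature.Computability.AlgebraicComplexity.NestFreeMatchingPoly
import HarnessLib

/-!
# Route FifoMatching — crux `NNNotVP` (stmt-ValiantsHypothesis-11615), line `division_split`: objects

Definitions file for the registered line `Cruxes/NNNotVP/Lines/division_split.lean`, whose stubs
are stated over four objects the line declares locally (its § "Vocabulary of the line"). This file
puts them VERBATIM (same names, same bodies) into an importable module so that the line's stubs can
be proved by name in `Theorems/`:

* `σ n` — the variables of `NN_n`: ordered pairs of points of `Fin (2n)`;
* `NN n` — the nest-free (FIFO) matching polynomial over `ℝ≥0` (the library's
  `nestFreeMatchingPoly n ℝ≥0`);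
* `SuppFn g A` — the support function of a nonnegative polynomial `g` at a variable set `A`
  (some monomial of `g` uses only variables of `A`);
* `freeVars T g` — the substitution `x_v := 1` for `v ∈ T`.

No statement is asserted here. Honest framing: vocabulary only; the crux `NNNotVP` is OPEN (its
line rests on the open stubs `stub_zeroOneTransfer`, `stub_supportFnHard`,
`stub_spreadCofactorReduction`) and nothing here bears on `VP ≠ VNP`.
-/

noncomputable section

-- Sub = Summit single-conjunct layout: the duplicated namespace component is mandated by the tree.
set_option linter.dupNamespace false

namespace Summit.ValiantsHypothesis.ValiantsHypothesis.Theorems.FifoMatching.NNNotVP.DivisionSplit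

open MvPolynomial Literature.Computability.AlgebraicComplexity
open scoped NNReal BigOperators Classical

/-- The variables of `NN_n`: ordered pairs of points of `Fin (2n)` (verbatim the line's `σ`).
[folklore] -/
abbrev σ (n : ℕ) : Type := Fin (2 * n) × Fin (2 * n)

/-- `NN_n` over `ℝ≥0` (library definition; definitionally the term inlined in the route file;
verbatim the line's `NN`). [folklore] -/
abbrev NN (n : ℕ) : MvPolynomial (σ n) ℝ≥0 := nestFreeMatchingPoly n ℝ≥0

/-- The **support function** of a nonnegative polynomial `g` at a variable set `A`: some monomial
of `g` uses only variables of `A` (for `g = NN_n`: the ordered graph `A` has a nest-free perfect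
matching). It is exactly what a monotone computation of `g`, read over the Boolean semiring,
decides (verbatim the line's `SuppFn`). [folklore] -/
def SuppFn {τ : Type*} (g : MvPolynomial τ ℝ≥0) (A : Finset τ) : Prop :=
  ∃ m ∈ g.support, m.support ⊆ A

/-- Freeing the variables of `T`: the substitution `x_v := 1` for `v ∈ T` (a projection; verbatim
the line's `freeVars`). [folklore] -/
def freeVars {τ : Type*} (T : Finset τ) (g : MvPolynomial τ ℝ≥0) : MvPolynomial τ ℝ≥0 :=
  MvPolynomial.aeval (fun v => if v ∈ T then (1 : MvPolynomial τ ℝ≥0) else X v) g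

end Summit.ValiantsHypothesis.ValiantsHypothesis.Theorems.FifoMatching.NNNotVP.DivisionSplit

end
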